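/- Copyright: the b2b-balaban cell (near-miss cell 7), T⁴-continuum fan-out, lineage t4-ne7b-p1 (node U5c COUNT
member).  Released under the licence of the surrounding project. -/
import Summits.QuantumFields.BalabanUV.T4Continuum.Support.HistoryGenealogyDissolveClauses
import Summits.QuantumFields.BalabanUV.T4Continuum.Support.HistoryGenealogyJunction

/-!
# THE JUNCTION, PASS V (part 3a — the clauses for print's process with its fresh clusters dissolved): for leaf-05's
memory-generic process `RunInputM`, the dissolved bookkeeping `histM.dissolve` satisfies `WF`, the cover condition,
`NoFreshClusters` (by construction) AND the displayed memory-agnostic clauses `LevelClausesW` — under `NewOK`, the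
memory domination `Rm ≤ R`, the one-step domination `Rm t (k+1) ≤ R (t+1)`, non-degenerate memory `2 ≤ Rm t 1`, and
DISJOINT new regions (owner module of row NE7b, lineage `t4-ne7b-p1` gen 42; ruling R-OWNER-42-1 «pass V supersedes
pass T» = R-OWNER-22-7 (α) at the junction; re-open object (α), `SCOPE-alpha.md` v2.3 §5 row M4, located open point
G-M4-1 — PRE-POSITIONING ONLY)

Summits-side support leaf of the T⁴-continuum cell (rung (B)+1 on a FINITE torus only; NOT infinite volume, NOT the
mass gap, NOT the Clay statement; NOT a proof of the spine estimate NE7b, which is the cell's OWN estimate, NOT PRINTED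
and NOT PROVED).  [folklore] finite combinatorics and index-model geometry over parts 1a–2c of pass V and leaf-05's
`HistoryGenealogyInstantiateM*` (`RunInputM`, `histM`, `rnwM`, `invM`, `wf_histM`, `levelClausesW_histM`,
`mem_partsM_iff`, `mem_newsM_iff`, `rnwM_lab_iff`, …), the junction's `coverOK_histM`, leaf-01's memory kit; nothing
printed is asserted, no `def … : Prop` fact of Bałaban's (`NewDisjoint` is a displayed INPUT condition on OUR data),
no cite-tagged hypothesis, zero `sorry`.  B16 = [Balaban1989LargeFieldII] pp. 383–387, B15 = [Balaban1989LargeFieldI]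
pp. 177, 198 are manuscripts UNDER AUDIT; locators only.

WHAT.  §1 **`NewDisjoint`** (distinct new regions of one level are disjoint — the input normalisation M2 supplies:
overlapping face-connected regions are pre-merged, class and credit additive) and its consequences **`labelOK_histM`**
(a region of a fresh cluster is not the label `(0, domain)` of a component: it would be its whole cluster),
`fresh_rnwM` (a fresh cluster is never flagged at its own level: no stop at relative index `0`), `rnwM_pseudo`; §2 the
dissolved process bookkeeping **`histV := histM.dissolve splV`** with the chosen splice order `splV := splOf …`, and
`wf_histV`, `noFreshClusters_histV`, `coverOK_histV`, `splGood_splV`; §3 **`levelClausesW_histV`**: (G-new),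
(G-birth), (G-flow) by list surgery; (G-touch), (G-join) by part 2b; (G-readyW)∕(G-pendR) from the process's `Rm`-facts
(`invM`) through part 2c's DICHOTOMY — verbatim for the unchanged lines (domination `Rm ≤ R`), through the MEMORY SHIFT
for the V-lines (`Rm t (k+1) ≤ R (t+1)`, `2 ≤ Rm t 1`) —, and for the pseudo-parts of a virtual merger trivially
(births pending one step).  Part 3b re-runs the seven `RealisedDomainsW` fields on `histV`.

HONEST.  Proves nothing of Bałaban's; the identification of `RunInputM`'s inputs with (2.18)[III]∕(1.72)[V] stays
M2's residual reading; print's current-memory reading `ofCurrent` (finding #3) meets the two memory side conditions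
for non-increasing `R ≥ 2`, the frozen model `ofFrozen` does NOT meet the one-step domination in general (pass V is
for print's reading); by-name class of every `WALL-NE7b-P1.md` §2 binder UNCHANGED; NE7b NOT proved; spine 0∕9.
HONEST DEPENDENCY (cell): continuum YM on T⁴ ⇐ BetaPertH ∧ nine spine estimates (0/9 proved); BetaPertH ⇐ (D1) ∧ (D4)
∧ CAP+tail; G-an2-4 gates asym, D1 and NE2/3/4.  This file changes none of it. -/

open Finset
open Literature.MathematicalPhysics.QuantumFieldTheory.Balaban1983to89
open Literature.MathematicalPhysics.QuantumFieldTheory.Balaban1983to89.B13ScaleTransfer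
open Literature.MathematicalPhysics.QuantumFieldTheory.Balaban1983to89.B16SProfile
open Literature.MathematicalPhysics.QuantumFieldTheory.Balaban1983to89.B16MergeGeometry
open Summit.QuantumFields.BalabanUV.T4Continuum.HistoryAdmissible
open Summit.QuantumFields.BalabanUV.T4Continuum.HistoryRealise
open Summit.QuantumFields.BalabanUV.T4Continuum.HistoryRealisePrint
open Summit.QuantumFields.BalabanUV.T4Continuum.HistoryRealiseMemory
open Summit.QuantumFields.BalabanUV.T4Continuum.HistoryGenealogyExtraction
open Summit.QuantumFields.BalabanUV.T4Continuum.HistoryGenealogyRealise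
open Summit.QuantumFields.BalabanUV.T4Continuum.HistoryGenealogyRealise.GeomHistoryR
open Summit.QuantumFields.BalabanUV.T4Continuum.HistoryGenealogyPedigree
open Summit.QuantumFields.BalabanUV.T4Continuum.HistoryTouchComponents

namespace Summit.QuantumFields.BalabanUV.T4Continuum.HistoryGenealogyInstantiate

noncomputable section

open Classical

variable {d : ℕ}

/-- a duplicate-free list of length `≥ 2` has, for every member, another member [folklore] -/
theorem exists_mem_ne_of_two_le {α : Type*} {l : List α} (hnd : l.Nodup) (h2 : 2 ≤ l.length) (a : α) :
    ∃ b ∈ l, b ≠ a := by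
  match l, hnd, h2 with
  | [], _, h2 => simp at h2
  | [_], _, h2 => simp at h2
  | x :: y :: l, hnd, _ =>
      have hxy : x ≠ y := fun h => by rw [h, List.nodup_cons] at hnd; exact hnd.1 List.mem_cons_self
      by_cases hax : x = a
      · exact ⟨y, by simp, fun h => hxy (hax.trans h.symm)⟩
      · exact ⟨x, by simp, hax⟩

namespace RunInputM

variable (I : RunInputM d)

/-! ## §1 Disjoint new regions; labels; fresh clusters are unflagged -/

/-- **THE DISPLAYED INPUT CONDITION «DISJOINT NEW REGIONS»**: distinct new regions of one level have disjoint cube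
sets (M2 normalises print's regions so: overlapping face-connected regions are merged into one, classes and (1.79)
credits adding up — a statement about the INPUT, never asserted here). [folklore] -/
def NewDisjoint : Prop := ∀ ℓ, ∀ n ∈ I.N ℓ, ∀ n' ∈ I.N ℓ, n ≠ n' → Disjoint n.2 n'.2

variable {I}

/-- a new region of a fresh cluster of the process is a new vertex of the cluster's block [folklore] -/
theorem inr_mem_block_of_fresh_news (hN : I.NewOK) {j : ℕ} {T : Finset (Line d ⊕ Lab d)}
    (hT : T ∈ I.blocksM j (I.PrevM j)) {n : Lab d} (hn : n ∈ I.histM.news j (lab (I.newLineM j T))) : Sum.inr n ∈ T :=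
  (I.mem_newsM_iff hN hT).1 hn

/-- **THE LABEL CONDITION HOLDS FOR THE PROCESS** under `NewOK` and `NewDisjoint`: a region `n` of a fresh cluster
`c` is not the label of a live line of the same level — such a line's domain would be `n.2`, meet the cluster's
domain, hence be the cluster, which also contains a second, disjoint, nonempty region. [folklore] -/
theorem labelOK_histM (hN : I.NewOK) (hD : I.NewDisjoint) : I.histM.LabelOK := by
  intro j c hf n hn hnc
  obtain ⟨T, hT, rfl⟩ := I.mem_compM_iff.1 hf.mem
  obtain ⟨T', hT', hlab⟩ := I.mem_compM_iff.1 hnc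
  have hnT : Sum.inr n ∈ T := inr_mem_block_of_fresh_news hN hT hn
  have hnN : n ∈ I.N j := (I.inr_mem_vertM).1 (subset_of_mem_tcomps hT hnT)
  -- the line labelled `n` has domain `n.2`, which meets the cluster's domain: the blocks coincide
  have hD' : fam (I.P j) T' = n.2 := by
    have := congrArg Prod.snd hlab; rwa [lab_snd, newLineM_D] at this
  have hne : (n.2).Nonempty := ⟨n.1, (hN.ok j n hnN).1⟩
  have hsub : n.2 ⊆ fam (I.P j) T := by
    have := subset_fam (I.P j) hnT; exact this
  have hTT : T' = T := by
    by_contra hne'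
    obtain ⟨x, hx⟩ := hne
    exact Finset.disjoint_left.1 (fam_disjoint_of_ne hT' hT hne') (hD' ▸ hx) (hsub hx)
  -- a second region of the cluster is disjoint from `n` yet inside `n.2`
  obtain ⟨n', hn', hnn'⟩ := exists_mem_ne_of_two_le ((I.wf_histM hN).news_nodup j _) hf.two_le_news n
  have hn'T : Sum.inr n' ∈ T := inr_mem_block_of_fresh_news hN hT hn'
  have hn'N : n' ∈ I.N j := (I.inr_mem_vertM).1 (subset_of_mem_tcomps hT hn'T)
  have hsub' : n'.2 ⊆ n.2 := by rw [← hD', hTT]; exact subset_fam (I.P j) hn'T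
  have hx' : n'.1 ∈ n'.2 := (hN.ok j n' hn'N).1
  exact Finset.disjoint_left.1 (hD j n' hn'N n hnN hnn') hx' (hsub' hx')

/-- **A FRESH CLUSTER IS NOT FLAGGED AT ITS OWN LEVEL**: its line's last event is at that level, and no readiness
test stops at the relative index `0`. [folklore] -/
theorem fresh_rnwM (hN : I.NewOK) : ∀ j c, I.histM.Fresh j c → I.rnwM j c = false := by
  intro j c hf
  by_contra h
  rw [Bool.not_eq_false] at h
  obtain ⟨τ, hτ, hlab, hR⟩ : ∃ τ ∈ I.StM j, lab τ = c ∧ I.RnwM j τ := by simpa [rnwM] using h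
  obtain ⟨-, ht, -, -⟩ := I.invM hN j τ hτ
  rw [hlab, ComponentHistory.lastStep_pgenR_fresh hf] at ht
  have hstop : StopsM I.L I.s I.Rm τ.t τ.E (j - τ.t) := hR.1
  have := hstop.pos
  rw [ht] at this
  simp at this

/-- a pseudo-component is never flagged (it is no live line's label) [folklore] -/
theorem rnwM_pseudo (hN : I.NewOK) (hD : I.NewDisjoint) {j : ℕ} {n : Lab d} (hn : n ∈ I.histM.pseudo j) :
    I.rnwM j n = false := by
  by_contra h
  rw [Bool.not_eq_false] at h
  obtain ⟨τ, hτ, hlab, -⟩ : ∃ τ ∈ I.StM j, lab τ = n ∧ I.RnwM j τ := by simpa [rnwM] using h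
  exact ComponentHistory.not_mem_comp_of_mem_pseudo (labelOK_histM hN hD) hn
    (I.mem_compM_iff.2 (by obtain ⟨T, hT, rfl⟩ := I.mem_StM_iff.1 hτ; exact ⟨T, hT, hlab⟩))

variable (I)

/-! ## §2 The dissolved bookkeeping of the process -/

/-- the chosen splice order for the process [folklore] -/
def splV : ℕ → Lab d → Lab d → List (Lab d) := ComponentHistory.splOf I.histM RunInput.domL I.L I.s

/-- **THE DISSOLVED BOOKKEEPING OF PRINT'S PROCESS**: fresh clusters replaced by their regions, continued fresh
clusters spliced one level up (R-OWNER-22-7 (α) at the junction). [folklore] -/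
def histV : ComponentHistory (Lab d) := I.histM.dissolve I.splV

variable {I}

/-- the domain map reads a new region's own cubes (definitionally) [folklore] -/
theorem domL_newReg : ∀ j (n : Lab d), n ∈ I.histM.newReg j → RunInput.domL j n = n.2 := fun _ _ _ => rfl

/-- the chosen splice order is good (under `NewOK`, `Rm ≤ R`, `0 < L`) [folklore] -/
theorem splGood_splV (hN : I.NewOK) (hRm : ∀ t k, I.Rm t k ≤ I.R t) (hL : 0 < I.L) :
    I.histM.SplGood RunInput.domL I.L I.s I.splV :=
  ComponentHistory.splGood_splOf (I.wf_histM hN) (I.coverOK_histM hN) (I.levelClausesW_histM hN hRm).touch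
    (I.levelClausesW_histM hN hRm).dom_join domL_newReg hL

/-- `WF` of the dissolved process bookkeeping [folklore] -/
theorem wf_histV (hN : I.NewOK) (hRm : ∀ t k, I.Rm t k ≤ I.R t) (hD : I.NewDisjoint) (hL : 0 < I.L) : I.histV.WF :=
  ComponentHistory.wf_dissolve (I.wf_histM hN) (ComponentHistory.spliceOK_of_splGood (splGood_splV hN hRm hL))
    (labelOK_histM hN hD)

/-- **NO FRESH CLUSTERS in the dissolved process bookkeeping** — the junction's displayed condition DISCHARGED.
[folklore] -/
theorem noFreshClusters_histV (hN : I.NewOK) (hRm : ∀ t k, I.Rm t k ≤ I.R t) (hD : I.NewDisjoint) (hL : 0 < I.L) :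
    NoFreshClusters I.histV :=
  noFreshClusters_dissolve (I.wf_histM hN) (ComponentHistory.spliceOK_of_splGood (splGood_splV hN hRm hL))
    (labelOK_histM hN hD)

/-- the cover condition for the dissolved process bookkeeping [folklore] -/
theorem coverOK_histV (hN : I.NewOK) (hRm : ∀ t k, I.Rm t k ≤ I.R t) (hD : I.NewDisjoint) (hL : 0 < I.L) :
    CoverOK I.histV RunInput.domL I.L I.s :=
  ComponentHistory.coverOK_dissolve (I.wf_histM hN) (labelOK_histM hN hD)
    (ComponentHistory.spliceOK_of_splGood (splGood_splV hN hRm hL)) (I.coverOK_histM hN) domL_newReg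

/-! ## §3 The memory-agnostic clauses for the dissolved process bookkeeping -/

/-- a splice with nonempty replacements on the listed parts that is a lone new region comes from a lone new region
[folklore] -/
theorem eq_singleton_inr_of_splice {α β : Type*} {pV : α → List α} {l : List (α ⊕ β)} {n : β}
    (hne : ∀ p, Sum.inl p ∈ l → pV p ≠ []) (h : splice pV l = [Sum.inr n]) : l = [Sum.inr n] := by
  match l, hne, h with
  | [], _, h => simp at h
  | Sum.inl p :: l, hne, h =>
      rw [splice_cons_inl] at h
      obtain ⟨q, qs, hq⟩ := List.exists_cons_of_ne_nil (hne p List.mem_cons_self)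
      rw [hq] at h; simp at h
  | Sum.inr m :: l, hne, h =>
      rw [splice_cons_inr] at h
      obtain ⟨hm, hl⟩ := List.cons.inj h
      rw [Sum.inr.inj hm]
      have : l = [] := by
        by_contra hl'
        have := length_le_length_splice_of l fun q hq => hne q (List.mem_cons_of_mem _ hq)
        rw [hl, List.length_nil, Nat.le_zero, List.length_eq_zero_iff] at this
        exact hl' this
      rw [this]

/-- a splice with nonempty replacements on the listed parts that is a lone old part comes from a lone old part whose
replacement is that part [folklore] -/
theorem eq_singleton_inl_of_splice {α β : Type*} {pV : α → List α} {l : List (α ⊕ β)} {q : α}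
    (hne : ∀ p, Sum.inl p ∈ l → pV p ≠ []) (h : splice pV l = [Sum.inl q]) : ∃ p, l = [Sum.inl p] ∧ pV p = [q] := by
  match l, hne, h with
  | [], _, h => simp at h
  | Sum.inr m :: l, _, h => rw [splice_cons_inr] at h; simp at h
  | Sum.inl p :: l, hne, h =>
      rw [splice_cons_inl] at h
      have h1 : 1 ≤ (pV p).length := List.length_pos_iff.2 (hne p List.mem_cons_self)
      have hlen := congrArg List.length h
      rw [List.length_append, List.length_map, List.length_singleton] at hlen
      have hl0 : (splice pV l).length = 0 := by omega
      have hl : l = [] := by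
        have := length_le_length_splice_of l fun q hq => hne q (List.mem_cons_of_mem _ hq)
        rw [hl0, Nat.le_zero, List.length_eq_zero_iff] at this; exact this
      subst hl
      rw [splice_nil, List.append_nil] at h
      obtain ⟨r, rs, hr⟩ := List.exists_cons_of_ne_nil (hne p List.mem_cons_self)
      rw [hr] at h
      simp only [List.map_cons, List.cons.injEq, Sum.inl.injEq, List.map_eq_nil_iff] at h
      obtain ⟨rfl, rfl⟩ := h
      exact ⟨p, rfl, hr⟩

/-- **THE DISPLAYED CLAUSES, MEMORY-AGNOSTIC FORM, HOLD FOR THE DISSOLVED PROCESS BOOKKEEPING** under `NewOK`, the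
domination `Rm t k ≤ R t`, the one-step domination `Rm t (k+1) ≤ R (t+1)`, non-degenerate memory `2 ≤ Rm t 1`,
disjoint new regions and `0 < L`. [folklore] -/
theorem levelClausesW_histV (hN : I.NewOK) (hRm : ∀ t k, I.Rm t k ≤ I.R t) (hRmS : ∀ t k, I.Rm t (k + 1) ≤ I.R (t + 1))
    (hRm2 : ∀ t, 2 ≤ I.Rm t 1) (hD : I.NewDisjoint) (hL : 0 < I.L) :
    LevelClausesW I.histV I.rnwM RunInput.domL I.L I.s I.R := by
  have hW := I.wf_histM hN
  have hLab := labelOK_histM hN hD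
  have hSG := splGood_splV hN hRm hL
  have hSO := ComponentHistory.spliceOK_of_splGood hSG
  have hGM := I.levelClausesW_histM hN hRm
  have hFr := fresh_rnwM hN
  have hdich := ComponentHistory.lastStep_edomR_dissolve (rnw := I.rnwM) (dom := RunInput.domL) (L := I.L) (s := I.s)
    hW hSO hLab hFr hGM.dom_flow
  refine ⟨fun j n hn => hN.ok j n hn, ?_, ?_, ?_, ?_, ?_, ?_⟩
  · -- (G-birth)
    intro j c n hc hcs
    rcases ComponentHistory.real_or_pseudo hLab hc with ⟨hcm, hf, hp⟩ | ⟨hp, -⟩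
    · cases j with
      | zero => rw [show I.histV.constit 0 c = _ from I.histM.constit_dissolve_zero I.splV hcm hf hp] at hcs
                exact hGM.dom_birth 0 c n hcm hcs
      | succ j =>
          rw [show I.histV.constit (j + 1) c = _ from I.histM.constit_dissolve_succ I.splV hcm hf hp] at hcs
          exact hGM.dom_birth (j + 1) c n hcm (eq_singleton_inr_of_splice
            (fun p hp' => ComponentHistory.partV_ne_nil hSO hcm ((mem_lefts_iff p _).2 hp')) hcs)
    · rw [show I.histV.constit j c = _ from I.histM.constit_dissolve_pseudo I.splV hp] at hcs
      have := (List.cons.inj hcs).1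
      rw [Sum.inr.inj this]; rfl
  · -- (G-flow)
    intro j c p hc hcs
    rcases ComponentHistory.real_or_pseudo hLab hc with ⟨hcm, hf, hp⟩ | ⟨hp, -⟩
    · rw [show I.histV.constit (j + 1) c = _ from I.histM.constit_dissolve_succ I.splV hcm hf hp] at hcs
      obtain ⟨q, hq, hpq⟩ := eq_singleton_inl_of_splice
        (fun p hp' => ComponentHistory.partV_ne_nil hSO hcm ((mem_lefts_iff p _).2 hp')) hcs
      by_cases hfq : I.histM.Fresh j q
      · -- a fresh part is replaced by ≥ 2 regions, never by one
        rw [I.histM.partV_of_fresh I.splV c hfq] at hpq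
        have hqm : q ∈ I.histM.parts (j + 1) c := (mem_lefts_iff q _).2 (by rw [hq]; simp)
        have := (hSO j c q hcm hqm hfq).length_eq
        rw [hpq, List.length_singleton] at this
        have h2 := hfq.two_le_news
        omega
      · rw [I.histM.partV_of_not_fresh I.splV c hfq, List.cons.injEq] at hpq
        rw [← hpq.1]
        exact hGM.dom_flow j c q hcm hq
    · rw [show I.histV.constit (j + 1) c = _ from I.histM.constit_dissolve_pseudo I.splV hp] at hcs
      simp at hcs
  · -- (G-readyW)
    intro j c hc p hp hflag
    rcases ComponentHistory.real_or_pseudo hLab hc with ⟨hcm, hf, hpc⟩ | ⟨hpc, -⟩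
    · have hnp : p ∉ I.histM.pseudo j := fun h => by
        have := rnwM_pseudo hN hD h; rw [hflag] at this; exact Bool.noConfusion this
      rcases (I.histM.mem_parts_dissolve_succ_iff I.splV hcm hf hpc).1 hp with ⟨hpm, hfp⟩ | ⟨q, hqm, hfq, hpq⟩
      · obtain ⟨T, hT, rfl⟩ := I.mem_compM_iff.1 hcm
        obtain ⟨τ, hτT, rfl⟩ := (I.mem_partsM_iff hN hT).1 hpm
        obtain ⟨hτ, -⟩ := I.mem_StM_of_inl_mem_blockM hT hτT
        obtain ⟨-, hlast, hedom, hfirst⟩ := I.invM hN j τ hτ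
        have hR : I.RnwM j τ := (I.rnwM_lab_iff hN hτ).1 hflag
        have hstop : StopsM I.L I.s I.Rm τ.t τ.E (j - τ.t) := hR.1
        have hpos := hstop.pos
        rcases hdich j (lab τ) (hW.parts_sub j _ hcm _ hpm) hfp with ⟨h1, h2⟩ | ⟨h1, -, h3⟩
        · rw [show (I.histV.pgenR I.rnwM j (lab τ)).lastStep = _ from h1,
            show edomR I.histV I.rnwM RunInput.domL j (lab τ) = _ from h2, ← hlast, ← hedom]
          exact ⟨by omega, hstop.condI, fun k hk => I.not_stops_of_not_stopsM hRm (hfirst k hk)⟩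
        · rw [show (I.histV.pgenR I.rnwM j (lab τ)).lastStep = _ from h1,
            show edomR I.histV I.rnwM RunInput.domL j (lab τ) = _ from h3, ← hlast, ← hedom]
          have hlt : τ.t + 1 < j := succ_lt_of_stopsM hRm2 hstop
          exact ⟨hlt, condI_shift hlt.le hstop.condI,
            fun k hk => not_stops_succ_of_not_stopsM (hRmS τ.t k) (hfirst (k + 1) (by omega))⟩
      · -- a pseudo-part is never flagged
        have : p ∈ I.histM.pseudo j :=
          I.histM.mem_pseudo_iff.2 ⟨q, hfq, (ComponentHistory.mem_spl_iff hSO hcm hqm hfq).1 hpq⟩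
        exact absurd this hnp
    · rw [ComponentHistory.parts, show I.histV.constit (j + 1) c = _ from
        I.histM.constit_dissolve_pseudo I.splV hpc] at hp
      simp at hp
  · -- (G-pendR)
    intro j c hc _ p hp hflag
    rcases ComponentHistory.real_or_pseudo hLab hc with ⟨hcm, hf, hpc⟩ | ⟨hpc, -⟩
    · rcases (I.histM.mem_parts_dissolve_succ_iff I.splV hcm hf hpc).1 hp with ⟨hpm, hfp⟩ | ⟨q, hqm, hfq, hpq⟩
      · obtain ⟨T, hT, rfl⟩ := I.mem_compM_iff.1 hcm
        obtain ⟨τ, hτT, rfl⟩ := (I.mem_partsM_iff hN hT).1 hpm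
        obtain ⟨hτ, halive⟩ := I.mem_StM_of_inl_mem_blockM hT hτT
        obtain ⟨ht, hlast, hedom, hfirst⟩ := I.invM hN j τ hτ
        have hnr : ¬ I.RnwM j τ := fun h => by
          have := (I.rnwM_lab_iff hN hτ).2 h; rw [hflag] at this; exact Bool.false_ne_true this
        have hunready : ¬ StopsM I.L I.s I.Rm τ.t τ.E (j - τ.t) := I.not_rdyM_of_aliveM_not_rnwM halive hnr
        have hall : ∀ k, k ≤ j - τ.t → ¬ StopsM I.L I.s I.Rm τ.t τ.E k := fun k hk => by
          by_cases hkj : k < j - τ.t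
          · exact hfirst k hkj
          · have : k = j - τ.t := by omega
            rw [this]; exact hunready
        rcases hdich j (lab τ) (hW.parts_sub j _ hcm _ hpm) hfp with ⟨h1, h2⟩ | ⟨h1, -, h3⟩
        · rw [show (I.histV.pgenR I.rnwM j (lab τ)).lastStep = _ from h1,
            show edomR I.histV I.rnwM RunInput.domL j (lab τ) = _ from h2, ← hlast, ← hedom]
          exact ⟨ht.trans (Nat.le_succ j), fun k hk => I.not_stops_of_not_stopsM hRm (hall k (by omega))⟩
        · rw [show (I.histV.pgenR I.rnwM j (lab τ)).lastStep = _ from h1,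
            show edomR I.histV I.rnwM RunInput.domL j (lab τ) = _ from h3, ← hlast, ← hedom]
          exact ⟨by omega, fun k hk => not_stops_succ_of_not_stopsM (hRmS τ.t k) (hall (k + 1) (by omega))⟩
      · -- a pseudo-part: a birth of level `j`, pending through `j + 1` trivially
        have hps : p ∈ I.histM.pseudo j :=
          I.histM.mem_pseudo_iff.2 ⟨q, hfq, (ComponentHistory.mem_spl_iff hSO hcm hqm hfq).1 hpq⟩
        rw [show I.histV.pgenR I.rnwM j p = _ from ComponentHistory.pgenR_dissolve_pseudo hps,
          show edomR I.histV I.rnwM RunInput.domL j p = _ from ComponentHistory.edomR_dissolve_pseudo domL_newReg hW hps]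
        exact pendingBefore_succ_self I.L I.s I.R j p.2
    · rw [ComponentHistory.parts, show I.histV.constit (j + 1) c = _ from
        I.histM.constit_dissolve_pseudo I.splV hpc] at hp
      simp at hp
  · -- (G-touch)
    intro j c hc h2
    exact ComponentHistory.chainTouch_constit_dissolve hW hLab hSG (I.coverOK_histM hN) hGM.touch hGM.dom_join
      domL_newReg hc h2
  · -- (G-join)
    intro j c hc h2
    exact ComponentHistory.dom_subset_unionL_dissolve hW hLab hSG (I.coverOK_histM hN) hGM.dom_join hGM.dom_flow
      domL_newReg hc h2

end RunInputM

end

end Summit.QuantumFields.BalabanUV.T4Continuum.HistoryGenealogyInstantiate
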